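import Summits.BirchSwinnertonDyer.BirchSwinnertonDyer.Theorems.PrintCFramBottomClassIndexLawFiveLeSelmerCountLocalLineCount
import Summits.BirchSwinnertonDyer.BirchSwinnertonDyer.Theorems.PrintCFramBottomClassIndexLawFiveLeSelmerDevissageLocalCriterion
import Summits.BirchSwinnertonDyer.BirchSwinnertonDyer.Theorems.PrintCFramBottomClassIndexLawFiveLeSelmerCountLowerBound
import Summits.BirchSwinnertonDyer.BirchSwinnertonDyer.Theorems.PrintCFramBottomClassIndexLawFiveLeBorelVisibilitySign
import Summits.BirchSwinnertonDyer.BirchSwinnertonDyer.Theorems.PrintCFramBottomClassIndexLawFiveLeLevelDictionaryPadic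
import Literature.NumberTheory.EllipticCurves.CasselsTateSelmerKolyvaginValue
import Literature.NumberTheory.EllipticCurves.LocalKummerMap
import HarnessLib

/-!
# Route `PrintCFram`, crux C2 `BottomClassIndexLawFiveLe` (stmt-BirchSwinnertonDyer-20372), line
# `eisenstein-resource-bdp-line` (registry v19, stub B1 `stub_bsdp_of_classFactor`): **CO-ALIGNED FROM THE LOCAL KUMMER CRITERION
# AND TATE'S LOCAL EULER CHARACTERISTIC** — (LA) ⟹ CO-ALIGNED; hence (LA) ∧ `#R_rel(Φ) ≥ p²` ⟹ `Ш(W/ℚ)[p] ≠ 0` on the class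
# (cell `bsd-print-cfram`, width seat `bsd-line-cfram-p1-w2` g10; helper `--supports` 20372; 0 defs, 0 facts, 0 sorry;
# CONDITIONAL on the tree's named fact `localEulerPoincareCharacteristic ℚ_v`, Milne I Thm 2.8)

HONEST FRAMING. Nothing about BSD is proved here and no stub is closed. This file joins two lanes of the B1 Selmer census:
seat g9/g10's counts (`…SelmerDevissageCountRationalAligned`, `…SelmerCountLowerBound`: the residual groups of the two characters of the
rational line bound `Sel_p(W/ℚ)` above, and — on a CO-ALIGNED member — `R_rel(Φ)` injects into `Sel_p(W/ℚ)`) and w6 g4's LOCAL KUMMER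
CRITERION (`…SelmerDevissageLocalCriterion`: (LA) «every `P ∈ W(ℚ_v)` has a `Φ`-adapted `p`-th root» ⟹ ALIGNED; (LT) ⟹ TRANSVERSE; (LA) ∨ (LT),
never both). ALIGNED (`L_p ⊆ ℓ_S` in the plane `H¹(ℚ_v, W[p])`, `L_p` = the local Kummer condition, `ℓ_S` = the image of `H¹(ℚ_v, Φ)`) and
CO-ALIGNED (`ℓ_S ⊆ L_p`) are the two inclusions of ONE equality of lines; the bridge is the count `#ℓ_S ≤ #H¹(ℚ_v, Φ) = p = #L_p`, i.e.
Tate's local Euler–Poincaré characteristic for the character module `Φ|_{Γ_v}` (`#H⁰ · #H² · #(ℤ_v/p) = #H¹` with `H⁰ = 0` — `Φ` is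
ramified at `p` — and `#H² = #Hom_{Γ_v}(Φ, μ_p) = 0` — the inertia homothety `c` has `χ̄_p = c² ≢ c`). The Euler characteristic is the
tree's NAMED FACT `localEulerPoincareCharacteristic` (Milne I Thm 2.8; used the same way by `LocalEulerCharacteristicTorsion.lean` for
`W[n]`); local duality in bidegree `(2,0)` is the tree's THEOREM `natCard_two_eq_natCard_invariants_homRep`.

* §1 (sibling file `…SelmerCountLocalLineCount`) **`natCard_galoisCohomology_one_eq_prime_of_localEuler`** — `#H¹(ℚ_v, A) = p` for a
  character module of order `p` with `A^{Γ_v} = 0 = Hom_{Γ_v}(A, μ_p)`, from `localEulerPoincareCharacteristic ℚ_v`.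
* §2 **`coaligned_of_forall_exists_adaptedRoot`** — `W/ℚ` elliptic, `v ∋ p`, `Φ ≤ W[p]` stable of order `p`, `W(ℚ_v)[p] = 0`, `Φ^{D_p} = 0`,
  some `g ∈ D_p` acting on `Φ` as a scalar `c` with `χ̄_p(g) ≢ c`, `localEulerPoincareCharacteristic ℚ_v`, and w6 g4's (LA) VERBATIM ⊢
  seat g10's CO-ALIGNED VERBATIM (`∀ w : Γ_ℚ → Φ`, `[Φ.incl ∘ w] ∈ selmerLocalKer W ℚ_v p`). Proof: the local module `Φ|_{Γ_v}`
  (`DiscreteGaloisModule.ofIsOpenStabilizer`), `ι_loc = H¹(Φ.incl)`, `ℓ = range ι_loc`; `#ℓ ≤ p` (§1); `#𝓛_v = p`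
  (`natCard_kummerLocalConditionAt_adicCompletion`, `#(ℤ_v/p) = p`); `𝓛_v ≤ ℓ` by (LA) (a Kummer class is the class of the Kummer
  cocycle of an adapted root, which is `Φ`-valued up to the coboundary of an algebraic `p`-torsion point); so `ℓ = 𝓛_v`, and
  `res_v [Φ.incl ∘ w] = ι_loc [w ∘ res] ∈ ℓ` (`mem_selmerLocalKer_of_mem_kummerLocalConditionAt_res`).
* §3 on the CM-ramified class: `exists_decomp_homothety_ne_cyclotomic_of_cmRamified` (the `H²`-input from w4 g2's inertia homothety and
  `BorelHomothety.exists_scalar_quot_of_isRationalLine`: `χ̄_p(g) ≡ c²`, `c ≢ 0, 1`) and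
  **`exists_sha_ne_zero_of_forall_exists_adaptedRoot_of_sq_le_of_cmRamified`** — class member (CM, minimal, `CMRamified W p`, `p ≥ 5`),
  `rank W(ℚ) = 1`, `Φ` of order `p` with (LA) at `v ∋ p`, `#h1Unramified Φ.Sub S_p ≥ p²`, `localEulerPoincareCharacteristic ℚ_v`
  ⊢ `∃ c ∈ Ш(W/ℚ), c ≠ 0 ∧ p • c = 0`.

NET for B1 (seat notes w2g8 §4, w2g9 §2–3, LEAD g11 binders): the CASE R branch of the first-order census is now stated on `W(ℚ_p)` and its
`p`-division points (w6 g4) plus ONE global count: «(LA) ∧ `u_rel(θ_S) ≥ 2` ⟹ B1-sha branch», modulo Milne I 2.8. What is still missing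
for «CASE R ∧ EVEN-IRREGULAR ⟹ B1-sha» is the reflection LOWER bound `u_rel(ψ) ≥ 1 + r(θ_e)` (θ_e-radicals — the Herbrand unit, w7 g4,
and class radicals — give `ψ`-isotypic Kummer characters; w4 g8's LINK turns them into classes): a Kummer-side statement, not attempted here.

THEOREMS ONLY; no definition, no named fact, no `sorry`. BSD is not proved by any of this; no summit statement is proved by this seat.
References: [MilneADT2006] I Thm. 2.8, Cor. 2.3, Lemma 3.3; [SerreGaloisCohomology1997] II §5.2, §5.7; [SilvermanAEC2009] VIII.§2, X.§4
(diagram (**)); [GrossLMS1991] §9; [SilvermanCSS1997] Ch. II §7; [GreenbergLNM1716] §3; seat notes w2g9 §3, w6g4, LEAD g10 report §2(a).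
-/

set_option autoImplicit false
-- `…BirchSwinnertonDyer.BirchSwinnertonDyer.Theorems…` is the problem's mandated namespace (D-0017).
set_option linter.dupNamespace false

noncomputable section

open scoped Classical

namespace Summit.BirchSwinnertonDyer.BirchSwinnertonDyer.Theorems.PrintCFram.SelmerCount

open NumberField IsDedekindDomain Field WeierstrassCurve
open Literature.NumberTheory.EllipticCurves Literature.NumberTheory.GaloisRepresentations
  Literature.NumberTheory.EllipticCurves.GreenbergSelmer Literature.NumberTheory.EllipticCurves.Rank1Residual
open Literature.NumberTheory.GaloisRepresentations.DiscreteGaloisModule (mu MuCarrier)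
open Summit.BirchSwinnertonDyer.Rank1Residual.X2.ResidualDevissageModules
open scoped ContRepresentation

/-! ## §2 (LA) ⟹ CO-ALIGNED, granted the local Euler characteristic -/

section Coaligned

variable (W : WeierstrassCurve ℚ) [W.IsElliptic]
variable {p : ℕ} [hp : Fact p.Prime] (v : HeightOneSpectrum (𝓞 ℚ))
  (Φ : StableSubgroup (absoluteGaloisGroup ℚ) (geomTorsion W (p : ℤ)))

/-- In `ℤ/p`-like groups: an element of `μ_p(\bar ℚ_v)` killed by an integer prime to `p` is zero. [folklore] -/
theorem muCarrier_eq_zero_of_zsmul_eq_zero {m : ℤ} (hm : ¬ (p : ℤ) ∣ m) (x : MuCarrier (v.adicCompletion ℚ) p)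
    (hx : m • x = 0) : x = 0 := by
  haveI : NeZero p := ⟨hp.out.ne_zero⟩
  haveI : CharZero (v.adicCompletion ℚ) := charZero_adicCompletion v
  apply (muEquivZMod (v.adicCompletion ℚ) p).injective
  rw [map_zero]
  have h := congrArg (muEquivZMod (v.adicCompletion ℚ) p) hx
  rw [map_zsmul, map_zero, zsmul_eq_mul, mul_eq_zero] at h
  rcases h with h | h
  · exact absurd ((ZMod.intCast_zmod_eq_zero_iff_dvd m p).1 h) hm
  · exact h

/-- **(LA) ⟹ CO-ALIGNED at `v`, granted Tate's local Euler characteristic for `ℚ_v`.** `W/ℚ` elliptic, `p` prime, `v ∋ p`,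
`Φ ≤ W[p]` a stable subgroup of order `p`. ASSUME: `W(ℚ_v)[p] = 0`; `Φ` has no non-zero vector fixed by `D_p = decomp v`; some
`g ∈ D_p` acts on `Φ` as a scalar `c` with `χ̄_p(g) ≢ c (mod p)` (so `Hom_{Γ_v}(Φ, μ_p) = 0`); the named fact
`localEulerPoincareCharacteristic ℚ_v`; and w6 g4's (LA): every rational local point `P ∈ W(ℚ_v)` has a `Φ`-ADAPTED `p`-th root.
THEN `W` is CO-ALIGNED at `v` along `Φ`: for every continuous crossed homomorphism `w : Γ_ℚ → Φ`, the class `[Φ.incl ∘ w]` satisfies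
the Selmer local condition at `v`. PROOF («two lines in a plane»): in `H¹(Γ_v, W[p])` the local Kummer condition `𝓛_v` has `p`
elements (`#W(ℚ_v)/p = p`); (LA) puts `𝓛_v` inside the image `ℓ` of `H¹(Γ_v, Φ)` (a Kummer class is the class of the Kummer cocycle of
an adapted root, which is `Φ`-valued); `#ℓ ≤ #H¹(Γ_v, Φ) = p` (§1); so `ℓ = 𝓛_v`, and `res_v [Φ.incl ∘ w] ∈ ℓ`.
[cite: MilneADT2006, Ch. I §2 Thm. 2.8, §3 Lemma 3.3] [cite: SilvermanAEC2009, X.§4 (diagram (**))] [cite: SerreGaloisCohomology1997, II §5.7] -/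
theorem coaligned_of_forall_exists_adaptedRoot (hpv : ((p : ℕ) : 𝓞 ℚ) ∈ v.asIdeal)
    (hEP : localEulerPoincareCharacteristic (v.adicCompletion ℚ))
    (htors : Nat.card (nsmulAddMonoidHom p :
      (W.baseChange (v.adicCompletion ℚ)).toAffine.Point →+ _).ker = 1)
    (hcard : Nat.card Φ.Sub = p)
    (hSD : ∀ s : Φ.Sub, (∀ g ∈ decomp v, g • s = s) → s = 0)
    (hSμ : ∃ g ∈ decomp v, ∃ c : ℤ, (∀ s : Φ.Sub, g • s = c • s) ∧
      ((modNCyclotomicCharacter ℚ p g : (ZMod p)ˣ) : ZMod p) ≠ (c : ZMod p))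
    (hLA : ∀ P : (W.baseChange (v.adicCompletion ℚ)).toAffine.Point,
      ∃ R : localPoints W (v.adicCompletion ℚ),
        (p : ℤ) • R = Affine.Point.map (W' := W)
          (IsScalarTower.toAlgHom ℚ (v.adicCompletion ℚ) (AlgebraicClosure (v.adicCompletion ℚ))) P ∧
        ∀ σ : absoluteGaloisGroup (v.adicCompletion ℚ), ∃ t ∈ Φ.toAddSubgroup,
          σ • R - R = pointsMap W (v.adicCompletion ℚ) (t : geomPoints W))
    (w : contOneCocycles (discreteTopRep (absoluteGaloisGroup ℚ) Φ.Sub)) :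
    oneCocycleClass (discreteTopRep (absoluteGaloisGroup ℚ) (geomTorsion W (p : ℤ)))
      (contOneCocycles.pullback (ContinuousMonoidHom.id _)
        (resHomOfEquivariant (ContinuousMonoidHom.id _) Φ.incl Φ.incl_smul) w) ∈
      selmerLocalKer W (v.adicCompletion ℚ) (p : ℤ) := by
  have hpr : p.Prime := hp.out
  haveI : NeZero p := ⟨hpr.ne_zero⟩
  haveI : Finite Φ.Sub := Nat.finite_of_card_ne_zero (by rw [hcard]; exact hpr.ne_zero)
  -- notation (`res = absGaloisRestrict ℚ ℚ_v : Γ_v → Γ_ℚ` is written out; `resGal ℚ_v` is the same map, `rfl`)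
  let Γv := absoluteGaloisGroup (v.adicCompletion ℚ)
  let M := geomTorsion W (p : ℤ)
  let ρM : DiscreteGaloisModule (v.adicCompletion ℚ) M :=
    GaloisRep.restrictField (v.adicCompletion ℚ) (W.torsionGaloisModule (p : ℤ))
  have hcontM : ∀ m : M, Continuous fun g : absoluteGaloisGroup ℚ ↦ g • m :=
    LevelDictionary.continuous_smul_geomTorsion W (p : ℤ)
  have hcontS : ∀ s : Φ.Sub, Continuous fun g : absoluteGaloisGroup ℚ ↦ g • s := Φ.continuous_smul_sub hcontM
  -- the local module `Φ|_{Γ_v}`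
  let repS : Representation ℤ Γv Φ.Sub :=
    { toFun := fun σ ↦ (DistribSMul.toAddMonoidHom Φ.Sub (absGaloisRestrict ℚ (v.adicCompletion ℚ) σ)).toIntLinearMap
      map_one' := by
        ext s
        change absGaloisRestrict ℚ (v.adicCompletion ℚ) 1 • s = s
        rw [map_one, one_smul]
      map_mul' := fun σ τ ↦ by
        ext s
        change absGaloisRestrict ℚ (v.adicCompletion ℚ) (σ * τ) • s =
          absGaloisRestrict ℚ (v.adicCompletion ℚ) σ • (absGaloisRestrict ℚ (v.adicCompletion ℚ) τ • s)
        rw [map_mul, mul_smul] }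
  let ρS : DiscreteGaloisModule (v.adicCompletion ℚ) Φ.Sub :=
    DiscreteGaloisModule.ofIsOpenStabilizer repS fun s ↦ by
      have h : IsOpen ((fun g : absoluteGaloisGroup ℚ ↦ g • s) ⁻¹' {s}) :=
        (isOpen_discrete ({s} : Set Φ.Sub)).preimage (hcontS s)
      exact h.preimage (absGaloisRestrict ℚ (v.adicCompletion ℚ)).continuous
  have hρS : ∀ (σ : Γv) (s : Φ.Sub), ρS σ s = absGaloisRestrict ℚ (v.adicCompletion ℚ) σ • s := fun _ _ ↦ rfl
  -- `#H¹(Γ_v, Φ) = p` (§1)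
  have hinv : ∀ s : Φ.Sub, (∀ σ : Γv, ρS σ s = s) → s = 0 := fun s hs ↦
    hSD s fun g hg ↦ by
      obtain ⟨σ, rfl⟩ := (mem_decomp_iff v g).1 hg
      exact hs σ
  have hdual : ∀ f : HomCarrier Φ.Sub (MuCarrier (v.adicCompletion ℚ) p),
      (∀ (σ : Γv) (a : Φ.Sub), mu (v.adicCompletion ℚ) p σ (f a) = f (ρS σ a)) → f = 0 := by
    intro f hf
    obtain ⟨g, hg, c, hgc, hne⟩ := hSμ
    obtain ⟨σ₀, rfl⟩ := (mem_decomp_iff v g).1 hg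
    refine HomCarrier.ext fun a ↦ ?_
    have h := hf σ₀ a
    rw [mu_adicCompletion_apply, hρS, hgc, map_zsmul, ← natCast_zsmul] at h
    have h' : ((((modNCyclotomicCharacter ℚ p (absGaloisRestrict ℚ (v.adicCompletion ℚ) σ₀) : (ZMod p)ˣ) :
        ZMod p).val : ℤ) - c) • f a = 0 := by
      rw [sub_zsmul, h]; simp
    refine muCarrier_eq_zero_of_zsmul_eq_zero v (m := _) (fun hdvd ↦ hne ?_) (f a) h'
    rw [← sub_eq_zero, ← ZMod.natCast_zmod_val ((modNCyclotomicCharacter ℚ p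
        (absGaloisRestrict ℚ (v.adicCompletion ℚ) σ₀) : (ZMod p)ˣ) : ZMod p),
      ← Int.cast_natCast, ← Int.cast_sub, ZMod.intCast_zmod_eq_zero_iff_dvd]
    exact hdvd
  obtain ⟨hfinS, hcardS⟩ := natCard_galoisCohomology_one_eq_prime_of_localEuler v hpv hEP ρS hcard hinv hdual
  -- the map `ι_loc = H¹(Φ.incl) : H¹(Γ_v, Φ) → H¹(Γ_v, W[p])` and its range `ℓ`
  let fS : ρS.toContRepresentation →ⁱL ρM.toContRepresentation :=
    { toContinuousLinearMap := ⟨Φ.incl.toIntLinearMap, continuous_of_discreteTopology⟩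
      isIntertwining' := fun σ ↦ by ext s; rfl }
  let ιloc := galoisCohomology.map fS 1
  have hιloc : ∀ ws : contOneCocycles ρS.toTopRep, ιloc (oneCocycleClass _ ws) = oneCocycleClass ρM.toTopRep
      (contOneCocycles.pullback (ContinuousMonoidHom.id Γv) (X := ρS.toTopRep) (Y := ρM.toTopRep)
        (TopRep.ofHom ⟨fS.toContinuousLinearMap, fS.isIntertwining'⟩) ws) := fun ws ↦
    galoisCohomology.map_one_oneCocycleClass fS ws
  haveI : Finite ιloc.range := by
    haveI := hfinS
    exact Finite.of_surjective _ ιloc.rangeRestrict_surjective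
  have hℓ : Nat.card ιloc.range ≤ p := by
    haveI := hfinS
    calc Nat.card ιloc.range ≤ Nat.card (galoisCohomology ρS 1) :=
          Nat.card_le_card_of_surjective _ ιloc.rangeRestrict_surjective
      _ = p := hcardS
  -- `#𝓛_v = p`
  have hL : Nat.card (W.kummerLocalConditionAt (p : ℤ) (v.adicCompletion ℚ)) = p := by
    rw [W.natCard_kummerLocalConditionAt_adicCompletion v hpr.ne_zero, htors, one_mul,
      natCard_adicCompletionIntegers_quot_span_prime hpv]
  -- (LA) ⟹ `𝓛_v ≤ ℓ`
  have hLℓ : W.kummerLocalConditionAt (p : ℤ) (v.adicCompletion ℚ) ≤ ιloc.range := by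
    intro c hc
    obtain ⟨ψ, rfl⟩ := oneCocycleClass_surjective _ c
    rw [mem_kummerLocalConditionAt_iff, map_torsionPointsMapIntertwining_oneCocycleClass] at hc
    obtain ⟨Q, hQ⟩ := (oneCocycleClass_eq_zero_iff _ _).mp hc
    have hQ' : ∀ σ : Γv, pointsMap W (v.adicCompletion ℚ) ((ψ.1 σ : M) : geomPoints W) = σ • Q - Q := hQ
    -- `p • Q` is rational
    have hfix : ∀ σ : Γv, σ • ((p : ℤ) • Q) = (p : ℤ) • Q := by
      intro σ
      have h0 : (p : ℤ) • ((ψ.1 σ : M) : geomPoints W) = 0 := (mem_geomTorsion_iff W (p : ℤ) _).mp (ψ.1 σ).2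
      have h1 : (p : ℤ) • (σ • Q - Q) = 0 := by rw [← hQ' σ, ← map_zsmul, h0, map_zero]
      rw [smul_comm, ← sub_eq_zero, ← zsmul_sub, h1]
    obtain ⟨P, hP⟩ := @exists_map_eq_of_forall_smul_localPoints_eq ℚ _ W (v.adicCompletion ℚ) _ _
      (@PerfectField.ofCharZero (v.adicCompletion ℚ) _
        (charZero_of_injective_algebraMap (algebraMap ℚ (v.adicCompletion ℚ)).injective)) _ hfix
    obtain ⟨R, hR, hRΦ⟩ := hLA P
    -- `Q - R` is `p`-torsion, hence algebraic
    obtain ⟨t₀, ht₀⟩ := exists_geomTorsion_pointsMap_eq W v (T := Q - R) (by rw [zsmul_sub, ← hP, hR, sub_self])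
    have hps : ∀ σ : Γv, pointsMap W (v.adicCompletion ℚ) (absGaloisRestrict ℚ (v.adicCompletion ℚ) σ • (t₀ : geomPoints W)) =
        σ • pointsMap W (v.adicCompletion ℚ) (t₀ : geomPoints W) := fun σ ↦ pointsMap_smul W (v.adicCompletion ℚ) σ _
    -- the values of `ψ - ∂t₀` lie in `Φ`
    have hval : ∀ σ : Γv, ∃ t ∈ Φ.toAddSubgroup,
        (ψ.1 σ : M) - (absGaloisRestrict ℚ (v.adicCompletion ℚ) σ • t₀ - t₀) = t := by
      intro σ
      obtain ⟨t, htΦ, ht⟩ := hRΦ σ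
      refine ⟨t, htΦ, ?_⟩
      apply Subtype.ext
      apply pointsMapOfEmb_injective W (closureEmb (K := ℚ) (v.adicCompletion ℚ))
      change pointsMap W (v.adicCompletion ℚ) _ = pointsMap W (v.adicCompletion ℚ) _
      rw [AddSubgroup.coe_sub, AddSubgroup.coe_sub, Literature.NumberTheory.EllipticCurves.AddSubgroup.torsionBy.coe_smul,
        map_sub, map_sub, hQ' σ, hps, ht₀, ← ht, smul_sub]
      abel
    -- the `Φ`-valued continuous crossed homomorphism `wS = ψ - ∂t₀`
    haveI : ContinuousSub M := ⟨continuous_of_discreteTopology⟩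
    have hψc : Continuous fun σ : Γv ↦ (ψ.1 σ : M) - (absGaloisRestrict ℚ (v.adicCompletion ℚ) σ • t₀ - t₀) :=
      ψ.1.continuous.sub (((hcontM t₀).comp (absGaloisRestrict ℚ (v.adicCompletion ℚ)).continuous).sub continuous_const)
    let wf : Γv → Φ.Sub := fun σ ↦ ⟨(ψ.1 σ : M) - (absGaloisRestrict ℚ (v.adicCompletion ℚ) σ • t₀ - t₀), by
      obtain ⟨t, htΦ, ht⟩ := hval σ
      rw [ht]; exact htΦ⟩
    have hwf : ∀ σ, Φ.incl (wf σ) = (ψ.1 σ : M) - (absGaloisRestrict ℚ (v.adicCompletion ℚ) σ • t₀ - t₀) := fun _ ↦ rfl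
    have hwfc : Continuous wf := by
      refine (IsLocallyConstant.desc wf Φ.incl ?_ Φ.incl_injective).continuous
      rw [IsLocallyConstant.iff_continuous]
      exact hψc
    let wS : contOneCocycles ρS.toTopRep := ⟨⟨wf, hwfc⟩, fun g h ↦ by
      change wf (g * h) = wf g + absGaloisRestrict ℚ (v.adicCompletion ℚ) g • wf h
      apply Φ.incl_injective
      have hψ : (ψ.1 (g * h) : M) = ψ.1 g + absGaloisRestrict ℚ (v.adicCompletion ℚ) g • ψ.1 h := ψ.2 g h
      rw [map_add, Φ.incl_smul, hwf, hwf, hwf, hψ, map_mul (absGaloisRestrict ℚ (v.adicCompletion ℚ)) g h, mul_smul,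
        smul_sub, smul_sub]
      abel⟩
    refine ⟨oneCocycleClass _ wS, ?_⟩
    rw [hιloc]
    -- `[Φ.incl ∘ wS] = [ψ]`: the difference is the coboundary of `-t₀`
    have key : oneCocycleClass ρM.toTopRep (contOneCocycles.pullback (ContinuousMonoidHom.id Γv) (X := ρS.toTopRep)
        (Y := ρM.toTopRep) (TopRep.ofHom ⟨fS.toContinuousLinearMap, fS.isIntertwining'⟩) wS) -
        oneCocycleClass ρM.toTopRep ψ = 0 := by
      rw [← oneCocycleClass_sub]
      refine (oneCocycleClass_eq_zero_iff _ _).mpr ⟨-t₀, fun σ ↦ ?_⟩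
      change Φ.incl (wf σ) - ψ.1 σ = absGaloisRestrict ℚ (v.adicCompletion ℚ) σ • (-t₀) - (-t₀)
      rw [hwf, smul_neg]
      abel
    exact sub_eq_zero.mp key
  -- `ℓ = 𝓛_v`
  have hℓL : ιloc.range = W.kummerLocalConditionAt (p : ℤ) (v.adicCompletion ℚ) :=
    (AddSubgroup.eq_of_le_of_card_ge hLℓ (by rw [hL]; exact hℓ)).symm
  -- conclusion: `res_v [Φ.incl ∘ w] = ι_loc [w ∘ res] ∈ ℓ = 𝓛_v`
  apply mem_selmerLocalKer_of_mem_kummerLocalConditionAt_res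
  rw [res_torsionGaloisModule_oneCocycleClass, ← hℓL]
  let wloc : contOneCocycles ρS.toTopRep :=
    contOneCocycles.pullback (absGaloisRestrict ℚ (v.adicCompletion ℚ)) (X := discreteTopRep (absoluteGaloisGroup ℚ) Φ.Sub)
      (Y := ρS.toTopRep) (TopRep.ofHom ⟨ContinuousLinearMap.id ℤ Φ.Sub, fun _ ↦ rfl⟩) w
  refine ⟨oneCocycleClass _ wloc, ?_⟩
  rw [hιloc]
  exact congrArg (oneCocycleClass _) (Subtype.ext (ContinuousMap.ext fun σ ↦ rfl))

end Coaligned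

/-! ## §3 On the CM-ramified class: (LA) ∧ `#R_rel(Φ) ≥ p²` ⟹ `Ш(W/ℚ)[p] ≠ 0`, granted the local Euler characteristic -/

section Class

variable (W : WeierstrassCurve ℚ) [W.IsElliptic] [W.IsGloballyMinimal]
variable {p : ℕ} [hp : Fact p.Prime]

omit [W.IsGloballyMinimal] in
/-- **The inertia homothety at `p` is not cyclotomic on the line.** On the CM-ramified class (`p ≥ 5`), for every stable line
`Φ ≤ W[p]` of order `p` and the place `v ∋ p`: some `g ∈ D_p = decomp v` acts on `Φ` as an integer scalar `c` with `χ̄_p(g) ≢ c (mod p)`.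
Indeed the inertia homothety `g` (w4 g2 `BorelTorsion.exists_sq_mem_inertia_homothety`: `g = c` on ALL of `W[p]`, `c ≢ 1`) has
`χ̄_p(g) ≡ c·c` (determinant on an adapted basis, `BorelHomothety.exists_scalar_quot_of_isRationalLine`), and `c² ≢ c` as `c ≢ 0, 1`.
So `Hom_{Γ_v}(Φ, μ_p) = 0` — the `H²`-input of `coaligned_of_forall_exists_adaptedRoot`. [cite: GrossLMS1991, §9]
[cite: SilvermanCSS1997, Ch. II §7 Proposition (det ρ̄_m = χ_m)] -/
theorem exists_decomp_homothety_ne_cyclotomic_of_cmRamified (hCM : W.HasCM) (h5 : 5 ≤ p) (hram : CMRamified W p)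
    (Φ : StableSubgroup (absoluteGaloisGroup ℚ) (geomTorsion W (p : ℤ))) (hcard : Nat.card Φ.Sub = p)
    {v : HeightOneSpectrum (𝓞 ℚ)} (hpv : ((p : ℕ) : 𝓞 ℚ) ∈ v.asIdeal) :
    ∃ g ∈ decomp v, ∃ c : ℤ, (∀ s : Φ.Sub, g • s = c • s) ∧
      ((modNCyclotomicCharacter ℚ p g : (ZMod p)ˣ) : ZMod p) ≠ (c : ZMod p) := by
  have hpr : p.Prime := hp.out
  obtain ⟨g, hgI, -, c, hc1, hg⟩ := BorelTorsion.exists_sq_mem_inertia_homothety (W := W) p hCM h5 hram hpv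
    (adicCompletionPrime_mem_primesAbove ℚ v)
  have hgD : g ∈ decomp v := by
    have h := Ideal.inertia_le_decompositionSubgroup (absoluteGaloisGroup ℚ) (adicCompletionPrime ℚ v) hgI
    rw [decompositionSubgroup_adicCompletionPrime_eq_range] at h
    exact h
  refine ⟨g, hgD, c, fun s ↦ Φ.incl_injective (by rw [Φ.incl_smul, map_zsmul]; exact hg _), fun hχ ↦ ?_⟩
  -- the line and quotient scalars `a, d` of `g`, `a d ≡ χ̄_p(g)`
  have hΦ : IsRationalLine W p Φ.toAddSubgroup := ⟨hcard, fun σ P hP ↦ Φ.smul_mem' σ hP⟩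
  obtain ⟨a, d, hline, hquot, had⟩ := BorelHomothety.exists_scalar_quot_of_isRationalLine W p hΦ g
  rw [modPCyclotomicCharacterZMod_eq_modNCyclotomicCharacter, hχ] at had
  -- `a ≡ c` (on a non-zero vector of `Φ`) and `d ≡ c` (on a non-zero vector of `W[p]/Φ`)
  have hcardQ : Nat.card Φ.Quot = p := HerbrandLineRestriction.natCard_quot_eq_of_card_sub W Φ hcard
  haveI : Finite Φ.Sub := Nat.finite_of_card_ne_zero (by rw [hcard]; exact hpr.ne_zero)
  haveI : Nontrivial Φ.Sub := Finite.one_lt_card_iff_nontrivial.mp (by rw [hcard]; exact hpr.one_lt)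
  haveI : Finite Φ.Quot := Nat.finite_of_card_ne_zero (by rw [hcardQ]; exact hpr.ne_zero)
  haveI : Nontrivial Φ.Quot := Finite.one_lt_card_iff_nontrivial.mp (by rw [hcardQ]; exact hpr.one_lt)
  obtain ⟨x, hx⟩ := exists_ne (0 : Φ.Sub)
  obtain ⟨y, hy⟩ := exists_ne (0 : Φ.Quot)
  obtain ⟨m, rfl⟩ := Φ.proj_surjective y
  have hac : (a : ZMod p) = (c : ZMod p) := by
    refine HerbrandLineRestriction.intCast_eq_of_zsmul_eq (p := p) hcard hx (Φ.incl_injective ?_)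
    rw [map_zsmul, map_zsmul]
    exact (hline (Φ.incl x) x.2).symm.trans (hg _)
  have hdc : (d : ZMod p) = (c : ZMod p) := by
    have h1 : Φ.proj (g • m - d • m) = 0 := (QuotientAddGroup.eq_zero_iff _).mpr (hquot m)
    rw [map_sub, hg m, map_zsmul, map_zsmul, sub_eq_zero] at h1
    exact HerbrandLineRestriction.intCast_eq_of_zsmul_eq (p := p) hcardQ hy h1.symm
  -- `c² ≡ c` forces `c ≡ 0` or `c ≡ 1`: both absurd
  rw [Int.cast_mul, hac, hdc] at had
  have hc01 : (c : ZMod p) = 0 ∨ (c : ZMod p) = 1 := by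
    have h : (c : ZMod p) * ((c : ZMod p) - 1) = 0 := by rw [mul_sub, mul_one, had, sub_self]
    rcases mul_eq_zero.mp h with h | h
    · exact Or.inl h
    · exact Or.inr (sub_eq_zero.mp h)
  rcases hc01 with h0 | h1
  · -- `c ≡ 0`: `g` would kill the non-zero vector `x`
    obtain ⟨k, hk⟩ := (ZMod.intCast_zmod_eq_zero_iff_dvd c p).mp h0
    have hx' : g • x = 0 := by
      apply Φ.incl_injective
      rw [Φ.incl_smul, hg, map_zero, hk, mul_comm, mul_smul, natCast_zsmul, AddSubgroup.torsionBy.nsmul, smul_zero]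
    exact hx (by rw [← inv_smul_smul g x, hx', smul_zero])
  · exact hc1 ((ZMod.intCast_zmod_eq_zero_iff_dvd (c - 1) p).mp (by rw [Int.cast_sub, Int.cast_one, h1, sub_self]))

/-- **(LA) ∧ `#R_rel(Φ) ≥ p²` ⟹ `Ш(W/ℚ)[p] ≠ 0` ON THE CM-RAMIFIED CLASS, granted the local Euler characteristic.** `W/ℚ` globally
minimal with CM, `p ≥ 5` ramified in the CM field, `rank W(ℚ) = 1`, `v ∋ p`, `Φ ≤ W[p]` a stable line of order `p` such that every
rational local point `P ∈ W(ℚ_v)` has a `Φ`-adapted `p`-th root (w6 g4's (LA) — «`W` is ALIGNED at `p` along `Φ`», CASE R when `Φ`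
carries the odd character), and `#h1Unramified Φ.Sub S_p ≥ p²` (`u_rel(θ_S) ≥ 2`); ASSUME `localEulerPoincareCharacteristic ℚ_v`. THEN
`Ш(W/ℚ)` has a non-zero element killed by `p`. The class supplies `W(ℚ_v)[p] = 0`, `Φ^{D_p} = 0`, the non-cyclotomic homothety (this §),
so (LA) ⟹ CO-ALIGNED (§2), and seat g10's `exists_sha_ne_zero_of_coaligned_of_sq_le_of_cmRamified` concludes. READING: on the model
`W_ψ` in CASE R this is the B1-sha locus, granted `u_rel(ψ) ≥ 2` (even-irregularity via the reflection count — not in the tree).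
[cite: MilneADT2006, Ch. I §2 Thm. 2.8] [cite: SilvermanAEC2009, Thm. X.4.2] [cite: GrossLMS1991, §9] -/
theorem exists_sha_ne_zero_of_forall_exists_adaptedRoot_of_sq_le_of_cmRamified
    (hCM : W.HasCM) (hram : CMRamified W p) (h5 : 5 ≤ p) (hrank : W.mordellWeilRank = 1)
    {v : HeightOneSpectrum (𝓞 ℚ)} (hpv : ((p : ℕ) : 𝓞 ℚ) ∈ v.asIdeal)
    (hEP : localEulerPoincareCharacteristic (v.adicCompletion ℚ))
    (Φ : StableSubgroup (absoluteGaloisGroup ℚ) (geomTorsion W (p : ℤ))) (hcard : Nat.card Φ.Sub = p)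
    (hLA : ∀ P : (W.baseChange (v.adicCompletion ℚ)).toAffine.Point,
      ∃ R : localPoints W (v.adicCompletion ℚ),
        (p : ℤ) • R = Affine.Point.map (W' := W)
          (IsScalarTower.toAlgHom ℚ (v.adicCompletion ℚ) (AlgebraicClosure (v.adicCompletion ℚ))) P ∧
        ∀ σ : absoluteGaloisGroup (v.adicCompletion ℚ), ∃ t ∈ Φ.toAddSubgroup,
          σ • R - R = pointsMap W (v.adicCompletion ℚ) (t : geomPoints W))
    (hsq : p ^ 2 ≤ Nat.card ↥(h1Unramified Φ.Sub {v' : HeightOneSpectrum (𝓞 ℚ) | ((p : ℕ) : 𝓞 ℚ) ∈ v'.asIdeal})) :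
    ∃ c ∈ W.sha, c ≠ 0 ∧ p • c = 0 := by
  have htors : Nat.card (nsmulAddMonoidHom p :
      (W.baseChange (v.adicCompletion ℚ)).toAffine.Point →+ _).ker = 1 :=
    (W.natCard_ker_nsmul_adicCompletion_eq_one_iff hpv p).2
      (RamifiedSevenEllipticUnits.prime_nsmul_eq_zero_padic_of_hasCM_of_cmRamified W p hCM h5 hram)
  have hSD : ∀ s : Φ.Sub, (∀ g ∈ decomp v, g • s = s) → s = 0 := fun s hs ↦
    LevelDictionaryAlpha.sub_eq_zero_of_forall_inertia_smul_eq_at_p W Φ hCM h5 hram hcard hpv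
      (adicCompletionPrime_mem_primesAbove ℚ v) s fun g hg ↦ hs g (by
        have h := Ideal.inertia_le_decompositionSubgroup (absoluteGaloisGroup ℚ) (adicCompletionPrime ℚ v) hg
        rw [decompositionSubgroup_adicCompletionPrime_eq_range] at h
        exact h)
  have hSμ := exists_decomp_homothety_ne_cyclotomic_of_cmRamified W hCM h5 hram Φ hcard hpv
  refine exists_sha_ne_zero_of_coaligned_of_sq_le_of_cmRamified W p hCM hram h5 hrank Φ hcard (fun w v' hv' ↦ ?_) hsq
  have hvv : v' = v := Rat.HeightOneSpectrum.primesEquiv.injective (Subtype.ext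
    ((LevelDictionary.primesEquiv_eq_of_natCast_mem v' hp.out hv').trans
      (LevelDictionary.primesEquiv_eq_of_natCast_mem v hp.out hpv).symm))
  subst hvv
  exact coaligned_of_forall_exists_adaptedRoot W v' Φ hv' hEP htors hcard hSD hSμ hLA w

end Class

end Summit.BirchSwinnertonDyer.BirchSwinnertonDyer.Theorems.PrintCFram.SelmerCount

end
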